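import Literature.Analysis.UnboundedOperators.HeatKernelSmooth
import Mathlib.Analysis.InnerProductSpace.Laplacian
import Mathlib.Analysis.SpecialFunctions.Pow.Deriv
import Mathlib.Analysis.Calculus.ParametricIntegral
import Mathlib.Analysis.Calculus.ContDiff.Convolution
import Mathlib.Analysis.Calculus.BumpFunction.InnerProduct
import Mathlib.MeasureTheory.Measure.Haar.NormedSpace
import HarnessLib

/-!
# The heat equation for the caloric extension `e^{tΔ} f`, and caloric smoothing of test data

Analysis/UnboundedOperators support file (all results proved; no named facts). It serves the
discharge of `Literature.Analysis.FluidPDE.IsClassicalNSSolutionOn.isMildNSSolutionOn` (Fabes–Jones–Rivière 1972,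
Thm. 2.1 (i): classical solutions of Navier–Stokes are mild solutions), whose proof tests the
equation against the caloric field `ψ(τ) = e^{ν(t-τ)Δ}φ`, and therefore needs the *time*
regularity of the accepted caloric extension `Literature.heatExtension f t = heatKernel t ⋆ f`
(`HeatKernel.lean`; smoothness in `x` is the accepted `Literature.Analysis.UnboundedOperators.contDiff_heatExtension`, discharged in
`HeatKernelSmooth.lean`).

Let `E` be a finite-dimensional real inner product space (`n = finrank ℝ E`) with Lebesgue
measure, `F` a real Banach space, `G_t = heatKernel t` the Gauss–Weierstrass kernel.

## Main results

* `Literature.Analysis.UnboundedOperators.hasDerivAt_heatKernel_time`: `∂ₜ G_t(z) = (‖z‖²/(4t²) - n/(2t)) G_t(z)` for `0 < t`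
  and `Literature.Analysis.UnboundedOperators.contDiffOn_uncurry_heatKernel`: `G` is
  jointly `C^∞` on `(0, ∞) × E`.
* `Literature.Analysis.UnboundedOperators.laplacian_heatExtension_eq_integral`: for `f ∈ L^p`, `1 ≤ p ≤ ∞`, `0 < t`,
  `Δ(e^{tΔ}f)(x) = ∫ (‖x-y‖²/(4t²) - n/(2t)) G_t(x-y) f(y) dy`.
* `Literature.Analysis.UnboundedOperators.hasDerivAt_heatExtension_time`: **the heat equation** `∂ₜ e^{tΔ}f (x) = Δ(e^{tΔ}f)(x)`
  for `f ∈ L^p`, `1 ≤ p ≤ ∞`, `0 < t` (Evans, §2.3.1, Thm. 1 (ii); Folland, Thm. (4.3)).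
* `Literature.Analysis.UnboundedOperators.heatExtension_eq_integral_heatKernel_one` (parabolic scaling
  `e^{σΔ}g(x) = ∫ G_1(z) g(x - √σ z) dz`), `Literature.Analysis.UnboundedOperators.tendsto_heatExtension_nhdsWithin_prod`
  (`e^{σΔ}g(x) → g(x₀)` as `(σ, x) → (0⁺, x₀)` for bounded continuous `g`; Evans, Thm. 1 (iii))
  and `Literature.Analysis.UnboundedOperators.continuousOn_uncurry_heatExtension` (joint continuity on `(0, ∞) × E`).
* `Literature.Analysis.UnboundedOperators.contDiffOn_uncurry_heatExtension`: for compactly supported locally integrable `g`,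
  `(σ, x) ↦ e^{σΔ}g(x)` is jointly `C^∞` on `(0, ∞) × E` (Evans, Thm. 1 (i)).
* Derivatives fall on compactly supported data: `Literature.Analysis.UnboundedOperators.fderiv_heatExtension_of_hasCompactSupport`
  (`D e^{σΔ}g = e^{σΔ} Dg`), `Literature.Analysis.UnboundedOperators.laplacian_heatExtension_of_hasCompactSupport`
  (`Δ e^{σΔ}g = e^{σΔ} Δg`), `Literature.Analysis.UnboundedOperators.hasDerivAt_heatExtension_time_of_hasCompactSupport`
  (`∂_σ e^{σΔ}g = e^{σΔ} Δg`), `Literature.Analysis.UnboundedOperators.heatExtension_clm_comp` (commutes with continuous linear maps).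
* Bounds: `Literature.Analysis.UnboundedOperators.norm_heatExtension_le` (maximum principle `‖e^{σΔ}g‖_∞ ≤ ‖g‖_∞`),
  `Literature.Analysis.UnboundedOperators.lintegral_enorm_heatExtension_le` (`L¹` contraction in `lintegral` form).

## Proof notes

The time derivative under the integral sign is dominated on `t' ∈ [t/2, 2t]` by a fixed Gaussian
(`exists_abs_timeWeight_mul_heatKernel_le`, polynomial weights absorbed through the tree's
`one_add_pow_mul_exp_neg_mul_sq_le`), integrable against `‖f‖` for `f ∈ L^p` by the tree's
`integrable_gaussian_smul_of_memLp`; the Laplacian is the sum over an orthonormal frame of the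
pure second derivatives given by the tree's `fderiv_integral_heatKernel_smul_apply`. Joint
smoothness for compactly supported data: near `(σ₀, x₀)` the kernel may be truncated by a bump
`θ` equal to `1` on a large ball without changing the convolution, and Mathlib's
`contDiffOn_convolution_left_with_param` applies to the jointly smooth, uniformly compactly
supported truncated kernel `θ G_σ`.

## Mathlib search

Mathlib (this pin) has no heat kernel / heat semigroup on functions (searched `heatKernel`,
`gaussian` + `convolution`, `fundamental solution` in `Analysis/`): only the Fourier transform of
the Gaussian (`Analysis/SpecialFunctions/Gaussian/FourierTransform.lean`). Used from Mathlib: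
`hasDerivAt_integral_of_dominated_loc_of_deriv_le`, `contDiffOn_convolution_left_with_param`,
`HasCompactSupport.hasFDerivAt_convolution_right`, `HasCompactSupport.contDiff_convolution_right`,
`Measure.integral_comp_smul`, `continuous_of_dominated`,
`InnerProductSpace.laplacian_eq_iteratedFDeriv_orthonormalBasis`.

## References

* L. C. Evans, *Partial Differential Equations*, 2nd ed., AMS (2010), §2.3.1, Theorem 1
  (i)–(iii) and its proof (book pp. 47–48). [Evans2010]
* G. B. Folland, *Introduction to Partial Differential Equations*, 2nd ed. (1995), §4.A,
  Theorem (4.3) (`f ∈ L^p`: `u = f ∗ K_t` satisfies `∂ₜu = Δu` on `ℝⁿ × (0, ∞)`). [Folland1995PDE]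
* P. G. Lemarié-Rieusset, *The Navier–Stokes Problem in the 21st Century* (2016), §4.1 (the heat
  kernel), §6.2 (`W_{νt} ∗ ∂^α u₀ = ∂^α (W_{νt} ∗ u₀)`). [LemarieRieusset2016]
* M.-H. Giga, Y. Giga, J. Saal, *Nonlinear Partial Differential Equations* (2010), §1.1.2
  (`L^p` contraction). [GigaGigaSaal2010]
-/

open MeasureTheory Filter Topology Set InnerProductSpace Metric
open scoped Real ENNReal NNReal Convolution Laplacian

noncomputable section

namespace Literature.Analysis.UnboundedOperators


section Kernel

variable {E : Type*} [NormedAddCommGroup E] [InnerProductSpace ℝ E]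

/-- **Time derivative of the Gauss–Weierstrass kernel**: for `0 < t`,
`∂ₜ G_t(z) = (‖z‖²/(4t²) - n/(2t)) G_t(z)`, `n = finrank ℝ E` (the bracket is the "caloric
time weight" of the lemmas below). Evans, *PDE*, §2.3.1 (the computation `Φ_t = ΔΦ` away from
`t = 0`). [folklore] -/
theorem hasDerivAt_heatKernel_time {t : ℝ} (ht : 0 < t) (z : E) :
    HasDerivAt (fun s => heatKernel s z)
      ((‖z‖ ^ 2 / (4 * t ^ 2) - (Module.finrank ℝ E : ℝ) / (2 * t)) * heatKernel t z) t := by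
  set n : ℝ := (Module.finrank ℝ E : ℝ) with hn
  have h4 : (4 * π * t) ≠ 0 := by positivity
  have hA : HasDerivAt (fun s : ℝ => (4 * π * s) ^ (-n / 2))
      (4 * π * 1 * (-n / 2) * (4 * π * t) ^ (-n / 2 - 1)) t :=
    ((hasDerivAt_id' t).const_mul (4 * π)).rpow_const (Or.inl h4)
  have hB : HasDerivAt (fun s : ℝ => Real.exp (-‖z‖ ^ 2 / 4 * s⁻¹))
      (Real.exp (-‖z‖ ^ 2 / 4 * t⁻¹) * (-‖z‖ ^ 2 / 4 * -(t ^ 2)⁻¹)) t :=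
    ((hasDerivAt_inv ht.ne').const_mul (-‖z‖ ^ 2 / 4)).exp
  have hAB := hA.mul hB
  have heq : (fun s : ℝ => heatKernel s z) =
      fun s => (4 * π * s) ^ (-n / 2) * Real.exp (-‖z‖ ^ 2 / 4 * s⁻¹) := by
    funext s
    rw [heatKernel]
    congr 2
    ring
  rw [heq]
  refine hAB.congr_deriv ?_
  rw [Real.rpow_sub_one h4, heatKernel]
  field_simp
  ring

/-- **Joint smoothness of the Gauss–Weierstrass kernel** in `(t, z)` on `(0, ∞) × E`.
Evans, *PDE*, §2.3.1. [folklore] -/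
theorem contDiffOn_uncurry_heatKernel {m : WithTop ℕ∞} :
    ContDiffOn ℝ m (fun q : ℝ × E => heatKernel q.1 q.2) (Ioi (0 : ℝ) ×ˢ univ) := by
  rintro ⟨t, z⟩ ⟨ht, -⟩
  have ht' : (0 : ℝ) < t := ht
  apply ContDiffAt.contDiffWithinAt
  have h4 : (4 * π * t) ≠ 0 := by positivity
  have hA : ContDiffAt ℝ m (fun q : ℝ × E => (4 * π * q.1) ^ (-(Module.finrank ℝ E : ℝ) / 2))
      (t, z) :=
    (contDiffAt_const.mul contDiffAt_fst).rpow_const_of_ne (by simpa using h4)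
  have hB : ContDiffAt ℝ m (fun q : ℝ × E => Real.exp (-‖q.2‖ ^ 2 / (4 * q.1))) (t, z) := by
    refine ContDiffAt.exp ?_
    exact ((contDiffAt_snd.norm_sq ℝ).neg.div (contDiffAt_const.mul contDiffAt_fst)
      (by simpa using h4))
  exact hA.mul hB

/-- The caloric time weight `z ↦ ‖z‖²/(4t²) - n/(2t)` is continuous. [folklore] -/
theorem continuous_heatKernel_timeWeight (t : ℝ) :
    Continuous fun z : E => ‖z‖ ^ 2 / (4 * t ^ 2) - (Module.finrank ℝ E : ℝ) / (2 * t) := by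
  fun_prop

/-- The gradient structure of the Gauss–Weierstrass kernel, `∇G_t = G_t • V_t` with
`V_t(z) = -(1/(2t)) ⟪z, ·⟫` (from `Literature.Analysis.UnboundedOperators.hasFDerivAt_heatKernel`). Evans, *PDE*, §2.3.1. [folklore] -/
theorem hasFDerivAt_heatKernel_smul_innerSL (t : ℝ) (z : E) :
    HasFDerivAt (heatKernel (E := E) t) (heatKernel t z • ((-(1 / (2 * t))) • innerSL ℝ z)) z := by
  refine (hasFDerivAt_heatKernel t z).congr_fderiv ?_
  rw [smul_smul]
  congr 1
  ring

/-- **Uniform Gaussian domination of `∂ₜG_s`** for `s ∈ [t/2, 2t]`, `0 < t`: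
`|‖z‖²/(4s²) - n/(2s)| G_s(z) ≤ C exp (-‖z‖²/(16 t))` (polynomial weights are absorbed by the
Gaussian, `one_add_pow_mul_exp_neg_mul_sq_le`). [folklore] -/
theorem exists_abs_timeWeight_mul_heatKernel_le {t : ℝ} (ht : 0 < t) :
    ∃ C, 0 ≤ C ∧ ∀ s ∈ Icc (t / 2) (2 * t), ∀ z : E,
      |‖z‖ ^ 2 / (4 * s ^ 2) - (Module.finrank ℝ E : ℝ) / (2 * s)| * heatKernel s z ≤
        C * Real.exp (-(1 / (16 * t)) * ‖z‖ ^ 2) := by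
  set n : ℝ := (Module.finrank ℝ E : ℝ) with hn
  have hn0 : 0 ≤ n := by positivity
  set M : ℝ := 1 / t ^ 2 + n / t with hM
  have hM0 : 0 ≤ M := by positivity
  set A : ℝ := (4 * π * (t / 2)) ^ (-n / 2) with hA
  have hA0 : 0 ≤ A := by positivity
  have hb : 0 < 1 / (8 * t) := by positivity
  set D : ℝ := (Nat.factorial 2 : ℝ) * Real.exp (1 + 1 / (2 * (1 / (8 * t)))) with hD
  have hD0 : 0 ≤ D := by positivity
  refine ⟨M * A * D, by positivity, fun s hs z => ?_⟩
  have hs0 : 0 < s := by linarith [hs.1]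
  -- the polynomial weight
  have hw : |‖z‖ ^ 2 / (4 * s ^ 2) - n / (2 * s)| ≤ M * (1 + ‖z‖) ^ 2 := by
    have h1 : |‖z‖ ^ 2 / (4 * s ^ 2) - n / (2 * s)| ≤ ‖z‖ ^ 2 / (4 * s ^ 2) + n / (2 * s) := by
      refine (abs_sub _ _).trans ?_
      rw [abs_of_nonneg (by positivity), abs_of_nonneg (by positivity)]
    have h2 : ‖z‖ ^ 2 / (4 * s ^ 2) ≤ ‖z‖ ^ 2 / t ^ 2 := by
      refine div_le_div_of_nonneg_left (by positivity) (by positivity) ?_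
      nlinarith [hs.1]
    have h3 : n / (2 * s) ≤ n / t :=
      div_le_div_of_nonneg_left hn0 ht (by linarith [hs.1])
    have h4 : ‖z‖ ^ 2 / t ^ 2 + n / t ≤ M * (1 + ‖z‖) ^ 2 := by
      have hz : 0 ≤ ‖z‖ := norm_nonneg z
      have e1 : ‖z‖ ^ 2 / t ^ 2 ≤ 1 / t ^ 2 * (1 + ‖z‖) ^ 2 := by
        rw [div_eq_mul_inv, one_div, mul_comm]
        refine mul_le_mul_of_nonneg_left ?_ (by positivity)
        nlinarith
      have e2 : n / t ≤ n / t * (1 + ‖z‖) ^ 2 :=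
        le_mul_of_one_le_right (by positivity) (by nlinarith)
      calc ‖z‖ ^ 2 / t ^ 2 + n / t ≤ 1 / t ^ 2 * (1 + ‖z‖) ^ 2 + n / t * (1 + ‖z‖) ^ 2 :=
            add_le_add e1 e2
        _ = M * (1 + ‖z‖) ^ 2 := by rw [hM]; ring
    linarith
  -- the kernel
  have hK : heatKernel s z ≤ A * Real.exp (-(1 / (8 * t)) * ‖z‖ ^ 2) := by
    rw [heatKernel_eq]
    refine mul_le_mul ?_ ?_ (by positivity) hA0
    · exact Real.rpow_le_rpow_of_nonpos (by positivity) (by nlinarith [hs.1, Real.pi_pos])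
        (by rw [neg_div]; exact neg_nonpos.2 (by positivity))
    · refine Real.exp_le_exp.2 (mul_le_mul_of_nonneg_right (neg_le_neg ?_) (by positivity))
      exact one_div_le_one_div_of_le (by positivity) (by linarith [hs.2])
  -- absorb the weight
  have habs := one_add_pow_mul_exp_neg_mul_sq_le hb 2 (norm_nonneg z)
  have h16 : -(1 / (8 * t) / 2) = -(1 / (16 * t)) := by ring
  rw [h16] at habs
  calc |‖z‖ ^ 2 / (4 * s ^ 2) - n / (2 * s)| * heatKernel s z
      ≤ (M * (1 + ‖z‖) ^ 2) * (A * Real.exp (-(1 / (8 * t)) * ‖z‖ ^ 2)) :=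
        mul_le_mul hw hK (heatKernel_pos hs0 z).le (by positivity)
    _ = M * A * ((1 + ‖z‖) ^ 2 * Real.exp (-(1 / (8 * t)) * ‖z‖ ^ 2)) := by ring
    _ ≤ M * A * (D * Real.exp (-(1 / (16 * t)) * ‖z‖ ^ 2)) := by gcongr
    _ = M * A * D * Real.exp (-(1 / (16 * t)) * ‖z‖ ^ 2) := by ring

end Kernel

/-! ### The heat equation for `e^{tΔ} f`, `f ∈ L^p` -/

section HeatEquation

variable {E : Type*} [NormedAddCommGroup E] [InnerProductSpace ℝ E] [FiniteDimensional ℝ E]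
  [MeasurableSpace E] [BorelSpace E]
variable {F : Type*} [NormedAddCommGroup F] [NormedSpace ℝ F]

/-- The caloric extension as an integral against the reflected kernel,
`e^{tΔ} f (x) = ∫ G_t(x - y) • f y dy` (`convolution_lsmul_swap`). Evans, *PDE*, §2.3.1 (12). [folklore] -/
theorem heatExtension_eq_integral_sub (f : E → F) (t : ℝ) (x : E) :
    heatExtension f t x = ∫ y, heatKernel t (x - y) • f y := by
  rw [heatExtension, convolution_lsmul_swap]

/-- **Integrability of temperate-weight caloric integrands**: for `P` of temperate growth,
`f ∈ L^p` (`1 ≤ p ≤ ∞`) and `0 < t`, `y ↦ (P · G_t)(x - y) • f y` is integrable (the weight is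
absorbed by the Gaussian, which lies in the conjugate Lebesgue class). Folland, *Introduction to
PDE* (2nd ed.), proof of Thm. (4.3). [folklore] -/
theorem integrable_temperate_mul_heatKernel_smul {t : ℝ} (ht : 0 < t) {f : E → F} {p : ℝ≥0∞}
    (hf : MemLp f p volume) (hp : 1 ≤ p) {P : E → ℝ} (hP : P.HasTemperateGrowth) (x : E) :
    Integrable (fun y => (P (x - y) * heatKernel t (x - y)) • f y) := by
  obtain ⟨C, -, hC⟩ := heatKernel_mul_norm_le ht hP
  have hgi : Integrable (fun y => Real.exp (-(1 / (8 * t)) * ‖x - y‖ ^ 2) * ‖f y‖) := by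
    simpa only [smul_eq_mul] using
      integrable_gaussian_smul_of_memLp (by positivity : 0 < 1 / (8 * t)) x hf.norm hp
  refine (hgi.const_mul C).mono' ?_ (Eventually.of_forall fun y => ?_)
  · have hc : Continuous fun y => P (x - y) * heatKernel t (x - y) :=
      ((hP.1.continuous).comp (continuous_const.sub continuous_id)).mul
        ((continuous_heatKernel t).comp (continuous_const.sub continuous_id))
    exact hc.aestronglyMeasurable.smul hf.1
  · rw [norm_smul, norm_mul, Real.norm_of_nonneg (heatKernel_pos ht _).le]
    calc ‖P (x - y)‖ * heatKernel t (x - y) * ‖f y‖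
        = (heatKernel t (x - y) * ‖P (x - y)‖) * ‖f y‖ := by ring
      _ ≤ C * Real.exp (-(1 / (8 * t)) * ‖x - y‖ ^ 2) * ‖f y‖ :=
        mul_le_mul_of_nonneg_right (hC _) (norm_nonneg _)
      _ = _ := by ring

/-- **First directional derivatives of `e^{tΔ} f`** (`f ∈ L^p`, `0 < t`):
`∂ₑ e^{tΔ}f (x) = ∫ (-(1/(2t)) ⟪x - y, e⟫) G_t(x - y) • f y dy`. Folland, *Introduction to PDE*
(2nd ed.), Thm. (4.3) and the remark following it. [cite: Folland1995PDE, §4.A Theorem (4.3)] -/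
theorem fderiv_heatExtension_apply_eq_integral {t : ℝ} (ht : 0 < t) {f : E → F} {p : ℝ≥0∞}
    (hf : MemLp f p volume) (hp : 1 ≤ p) (x e : E) :
    fderiv ℝ (heatExtension f t) x e =
      ∫ y, ((-(1 / (2 * t)) * ⟪x - y, e⟫_ℝ) * heatKernel t (x - y)) • f y := by
  have hV : (fun z : E => (-(1 / (2 * t))) • innerSL ℝ z).HasTemperateGrowth :=
    (Function.HasTemperateGrowth.const _).fun_smul (innerSL ℝ (E := E)).hasTemperateGrowth
  have hU : heatExtension f t =
      fun x => ∫ y, ((fun _ : E => (1 : ℝ)) (x - y) * heatKernel t (x - y)) • f y := by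
    funext x
    rw [heatExtension_eq_integral_sub]
    simp
  rw [hU, fderiv_integral_heatKernel_smul_apply ht hf hp (Function.HasTemperateGrowth.const 1) hV
    (hasFDerivAt_heatKernel_smul_innerSL t) x e]
  refine integral_congr_ae (Eventually.of_forall fun y => ?_)
  simp [inner_sub_left]

/-- **Pure second directional derivatives of `e^{tΔ} f`** (`f ∈ L^p`, `0 < t`):
`∂ₑ∂ₑ e^{tΔ}f (x) = ∫ (-(‖e‖²/(2t)) + ⟪x - y, e⟫²/(4t²)) G_t(x - y) • f y dy`.
Folland, *Introduction to PDE* (2nd ed.), Thm. (4.3) and the remark following it. [cite: Folland1995PDE, §4.A Theorem (4.3)] -/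
theorem fderiv_fderiv_heatExtension_apply_eq_integral {t : ℝ} (ht : 0 < t) {f : E → F}
    {p : ℝ≥0∞} (hf : MemLp f p volume) (hp : 1 ≤ p) (x e : E) :
    fderiv ℝ (fun y => fderiv ℝ (heatExtension f t) y e) x e =
      ∫ y, ((-(1 / (2 * t)) * ‖e‖ ^ 2 + (1 / (2 * t)) ^ 2 * ⟪x - y, e⟫_ℝ ^ 2) *
        heatKernel t (x - y)) • f y := by
  have hV : (fun z : E => (-(1 / (2 * t))) • innerSL ℝ z).HasTemperateGrowth :=
    (Function.HasTemperateGrowth.const _).fun_smul (innerSL ℝ (E := E)).hasTemperateGrowth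
  have hP : (fun z => ((-(1 / (2 * t))) • innerSL ℝ e : E →L[ℝ] ℝ) z).HasTemperateGrowth :=
    ((-(1 / (2 * t))) • innerSL ℝ e : E →L[ℝ] ℝ).hasTemperateGrowth
  have h1 : (fun y => fderiv ℝ (heatExtension f t) y e) =
      fun y => ∫ w, ((fun z => ((-(1 / (2 * t))) • innerSL ℝ e : E →L[ℝ] ℝ) z) (y - w) *
        heatKernel t (y - w)) • f w := by
    funext y
    rw [fderiv_heatExtension_apply_eq_integral ht hf hp y e]
    refine integral_congr_ae (Eventually.of_forall fun w => ?_)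
    simp [real_inner_comm]
  rw [h1, fderiv_integral_heatKernel_smul_apply ht hf hp hP hV
    (hasFDerivAt_heatKernel_smul_innerSL t) x e]
  refine integral_congr_ae (Eventually.of_forall fun y => ?_)
  dsimp only
  have hfd : fderiv ℝ (fun z => ((-(1 / (2 * t))) • innerSL ℝ e : E →L[ℝ] ℝ) z) (x - y) =
      ((-(1 / (2 * t))) • innerSL ℝ e : E →L[ℝ] ℝ) :=
    ((-(1 / (2 * t))) • innerSL ℝ e : E →L[ℝ] ℝ).fderiv
  rw [hfd]
  congr 2
  simp only [_root_.add_apply, _root_.FunLike.coe_smul, Pi.smul_apply,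
    innerSL_apply_apply, smul_eq_mul, real_inner_self_eq_norm_sq, real_inner_comm e (x - y)]
  ring

/-- **The Laplacian of the caloric extension as a single integral** (`f ∈ L^p`, `1 ≤ p ≤ ∞`,
`0 < t`): `Δ e^{tΔ}f (x) = ∫ (‖x - y‖²/(4t²) - n/(2t)) G_t(x - y) • f y dy = ∫ ΔG_t(x - y) • f y dy`
(sum of the pure second derivatives over an orthonormal frame). Folland, *Introduction to PDE*
(2nd ed.), Thm. (4.3) ("differentiate under the integral"). [cite: Folland1995PDE, §4.A Theorem (4.3)] -/
theorem laplacian_heatExtension_eq_integral [CompleteSpace F] {t : ℝ} (ht : 0 < t) {f : E → F}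
    {p : ℝ≥0∞} (hf : MemLp f p volume) (hp : 1 ≤ p) (x : E) :
    (Δ (heatExtension f t)) x =
      ∫ y, ((‖x - y‖ ^ 2 / (4 * t ^ 2) - (Module.finrank ℝ E : ℝ) / (2 * t)) *
        heatKernel t (x - y)) • f y := by
  set b := stdOrthonormalBasis ℝ E with hb
  have hsm : ContDiff ℝ 2 (heatExtension f t) :=
    contDiff_infty.1 (contDiff_heatExtension_holds hf hp ht) 2
  -- the Laplacian as the sum of the pure second derivatives
  have hlap : (Δ (heatExtension f t)) x =
      ∑ i, fderiv ℝ (fun y => fderiv ℝ (heatExtension f t) y (b i)) x (b i) := by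
    rw [laplacian_eq_iteratedFDeriv_orthonormalBasis (heatExtension f t) b]
    refine Finset.sum_congr rfl fun i _ => ?_
    have hd : DifferentiableAt ℝ (fderiv ℝ (heatExtension f t)) x :=
      ((hsm.fderiv_right (m := 1) le_rfl).differentiable one_ne_zero) x
    rw [iteratedFDeriv_two_apply, fderiv_clm_apply hd (differentiableAt_const _)]
    simp
  rw [hlap]
  -- the weights of the summands have temperate growth
  have hinner : ∀ i, (fun z : E => ⟪z, b i⟫_ℝ).HasTemperateGrowth := fun i => by
    have := (innerSL ℝ (b i) : E →L[ℝ] ℝ).hasTemperateGrowth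
    convert this using 1
    funext z
    simp [real_inner_comm]
  have hP : ∀ i, (fun z : E => -(1 / (2 * t)) * ‖b i‖ ^ 2 +
      (1 / (2 * t)) ^ 2 * ⟪z, b i⟫_ℝ ^ 2).HasTemperateGrowth := fun i =>
    (Function.HasTemperateGrowth.const _).fun_add
      ((Function.HasTemperateGrowth.const _).fun_mul ((hinner i).fun_pow 2))
  have hint : ∀ i, Integrable (fun y => ((-(1 / (2 * t)) * ‖b i‖ ^ 2 +
      (1 / (2 * t)) ^ 2 * ⟪x - y, b i⟫_ℝ ^ 2) * heatKernel t (x - y)) • f y) := fun i =>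
    integrable_temperate_mul_heatKernel_smul ht hf hp (hP i) x
  simp_rw [fderiv_fderiv_heatExtension_apply_eq_integral ht hf hp x]
  rw [← integral_finsetSum _ fun i _ => hint i]
  refine integral_congr_ae (Eventually.of_forall fun y => ?_)
  dsimp only
  rw [← Finset.sum_smul, ← Finset.sum_mul]
  congr 2
  simp only [Finset.sum_add_distrib, ← Finset.mul_sum, b.sum_sq_inner_left, b.orthonormal.1,
    one_pow, Finset.sum_const, Finset.card_univ, Fintype.card_fin, nsmul_eq_mul, mul_one]
  field_simp
  ring

/-- **Time derivative of the caloric extension under the integral sign** (`f ∈ L^p`,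
`1 ≤ p ≤ ∞`, `0 < t`): `∂ₜ e^{tΔ}f (x) = ∫ ∂ₜG_t(x - y) • f y dy`, by dominated differentiation on
`t' ∈ [t/2, 2t]` (`exists_abs_timeWeight_mul_heatKernel_le` and Hölder,
`integrable_gaussian_smul_of_memLp`). Folland, *Introduction to PDE* (2nd ed.), Thm. (4.3);
Evans, *PDE*, §2.3.1, Thm. 1 (ii). [cite: Folland1995PDE, §4.A Theorem (4.3)] -/
theorem hasDerivAt_heatExtension_time_eq_integral {t : ℝ} (ht : 0 < t) {f : E → F} {p : ℝ≥0∞}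
    (hf : MemLp f p volume) (hp : 1 ≤ p) (x : E) :
    HasDerivAt (fun s => heatExtension f s x)
      (∫ y, ((‖x - y‖ ^ 2 / (4 * t ^ 2) - (Module.finrank ℝ E : ℝ) / (2 * t)) *
        heatKernel t (x - y)) • f y) t := by
  have hJ : Icc (t / 2) (2 * t) ∈ 𝓝 t := Icc_mem_nhds (by linarith) (by linarith)
  obtain ⟨C, -, hC⟩ := exists_abs_timeWeight_mul_heatKernel_le (E := E) ht
  have hb : 0 < 1 / (16 * t) := by positivity
  have hgi : Integrable (fun y => Real.exp (-(1 / (16 * t)) * ‖x - y‖ ^ 2) * ‖f y‖) := by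
    simpa only [smul_eq_mul] using integrable_gaussian_smul_of_memLp hb x hf.norm hp
  have hmeas : ∀ s, AEStronglyMeasurable (fun y => heatKernel s (x - y) • f y) volume := fun s =>
    ((continuous_heatKernel s).comp (continuous_const.sub continuous_id)).aestronglyMeasurable.smul
      hf.1
  have key := hasDerivAt_integral_of_dominated_loc_of_deriv_le
    (F := fun s y => heatKernel s (x - y) • f y)
    (F' := fun s y => ((‖x - y‖ ^ 2 / (4 * s ^ 2) - (Module.finrank ℝ E : ℝ) / (2 * s)) *
      heatKernel s (x - y)) • f y) (x₀ := t)
    (bound := fun y => C * (Real.exp (-(1 / (16 * t)) * ‖x - y‖ ^ 2) * ‖f y‖)) hJ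
    (Eventually.of_forall hmeas) ?_ ?_ ?_ (hgi.const_mul C) ?_
  · have heq : (fun s => heatExtension f s x) = fun s => ∫ y, heatKernel s (x - y) • f y :=
      funext fun s => heatExtension_eq_integral_sub f s x
    rw [heq]
    exact key.2
  · simpa using integrable_temperate_mul_heatKernel_smul ht hf hp
      (Function.HasTemperateGrowth.const 1) x
  · exact (((continuous_heatKernel_timeWeight t).comp (continuous_const.sub continuous_id)).mul
      ((continuous_heatKernel t).comp (continuous_const.sub continuous_id))).aestronglyMeasurable.smul
      hf.1
  · refine Eventually.of_forall fun y s hs => ?_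
    rw [norm_smul, norm_mul, Real.norm_of_nonneg (heatKernel_pos (by linarith [hs.1]) _).le,
      Real.norm_eq_abs]
    calc |‖x - y‖ ^ 2 / (4 * s ^ 2) - (Module.finrank ℝ E : ℝ) / (2 * s)| *
          heatKernel s (x - y) * ‖f y‖
        ≤ C * Real.exp (-(1 / (16 * t)) * ‖x - y‖ ^ 2) * ‖f y‖ :=
          mul_le_mul_of_nonneg_right (hC s hs _) (norm_nonneg _)
      _ = _ := by ring
  · refine Eventually.of_forall fun y s hs => ?_
    exact (hasDerivAt_heatKernel_time (by linarith [hs.1]) (x - y)).smul_const (f y)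

/-- **The heat equation for the caloric extension.** For `f ∈ L^p(E; F)`, `1 ≤ p ≤ ∞`, `F`
complete, `0 < t` and every `x`, `t ↦ e^{tΔ} f (x)` is differentiable with derivative
`Δ (e^{tΔ} f) (x)`, i.e. `u(x, t) = ∫ G_t(x - y) f(y) dy` solves `∂ₜu = Δu` on `E × (0, ∞)`.
Evans, *PDE* (2nd ed.), §2.3.1, Thm. 1 (ii) (bounded continuous data); Folland, *Introduction to
PDE* (2nd ed.), §4.A, Thm. (4.3) (`f ∈ L^p`: "`u = f ∗ K_t` … satisfies `∂ₜu = Δu` on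
`ℝⁿ × (0, ∞)`"). [cite: Folland1995PDE, §4.A Theorem (4.3)] [cite: Evans2010, §2.3.1 Theorem 1(ii)] -/
theorem hasDerivAt_heatExtension_time [CompleteSpace F] {t : ℝ} (ht : 0 < t) {f : E → F}
    {p : ℝ≥0∞} (hf : MemLp f p volume) (hp : 1 ≤ p) (x : E) :
    HasDerivAt (fun s => heatExtension f s x) ((Δ (heatExtension f t)) x) t := by
  rw [laplacian_heatExtension_eq_integral ht hf hp x]
  exact hasDerivAt_heatExtension_time_eq_integral ht hf hp x

end HeatEquation

/-! ### Compactly supported and bounded continuous data -/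

section SmoothData

variable {E : Type*} [NormedAddCommGroup E] [InnerProductSpace ℝ E] [FiniteDimensional ℝ E]
  [MeasurableSpace E] [BorelSpace E]
variable {F : Type*} [NormedAddCommGroup F] [NormedSpace ℝ F]

/-! ### Scaling: `e^{σΔ} g (x) = ∫ G_1(z) • g (x - √σ z) dz` and continuity up to `σ = 0` -/

omit [FiniteDimensional ℝ E] [MeasurableSpace E] [BorelSpace E] in
/-- **Parabolic scaling of the kernel**: `G_1(z) = (√σ)ⁿ G_σ(√σ z)` for `0 < σ`.
Evans, *PDE*, §2.3.1 (scaling invariance of the fundamental solution). [folklore] -/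
theorem heatKernel_one_eq_sqrt_pow_mul_heatKernel {σ : ℝ} (hσ : 0 < σ) (z : E) :
    heatKernel 1 z = Real.sqrt σ ^ Module.finrank ℝ E * heatKernel σ (Real.sqrt σ • z) := by
  set n : ℕ := Module.finrank ℝ E with hn
  rw [heatKernel_eq, heatKernel_eq]
  have h1 : ‖Real.sqrt σ • z‖ ^ 2 = σ * ‖z‖ ^ 2 := by
    rw [norm_smul, Real.norm_of_nonneg (Real.sqrt_nonneg σ), mul_pow, Real.sq_sqrt hσ.le]
  have h2 : Real.sqrt σ ^ n = σ ^ ((n : ℝ) / 2) := by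
    rw [Real.sqrt_eq_rpow, ← Real.rpow_natCast, ← Real.rpow_mul hσ.le]
    congr 1
    ring
  have h3 : (4 * π * σ) ^ (-(n : ℝ) / 2) = (4 * π) ^ (-(n : ℝ) / 2) * σ ^ (-(n : ℝ) / 2) :=
    Real.mul_rpow (by positivity) hσ.le
  have h4 : σ ^ ((n : ℝ) / 2) * σ ^ (-(n : ℝ) / 2) = 1 := by
    rw [← Real.rpow_add hσ, show (n : ℝ) / 2 + -(n : ℝ) / 2 = 0 by ring, Real.rpow_zero]
  have h5 : -(1 / (4 * σ)) * (σ * ‖z‖ ^ 2) = -(1 / (4 * 1)) * ‖z‖ ^ 2 := by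
    field_simp
  rw [h1, h2, h3, h5, mul_one]
  calc (4 * π) ^ (-(n : ℝ) / 2) * Real.exp (-(1 / (4 * 1)) * ‖z‖ ^ 2)
      = (σ ^ ((n : ℝ) / 2) * σ ^ (-(n : ℝ) / 2)) * ((4 * π) ^ (-(n : ℝ) / 2) *
          Real.exp (-(1 / (4 * 1)) * ‖z‖ ^ 2)) := by rw [h4, one_mul]
    _ = _ := by ring

/-- **Scaling representation of the caloric extension**: for `0 < σ`,
`e^{σΔ} g (x) = ∫ G_1(z) • g(x - √σ z) dz` (substitute `y = √σ z` in `∫ G_σ(y) • g(x - y) dy`).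
Evans, *PDE*, §2.3.1, proof of Thm. 1 (iii). [folklore] -/
theorem heatExtension_eq_integral_heatKernel_one {σ : ℝ} (hσ : 0 < σ) (g : E → F) (x : E) :
    heatExtension g σ x = ∫ z, heatKernel 1 z • g (x - Real.sqrt σ • z) := by
  rw [heatExtension_apply]
  have hR : 0 < Real.sqrt σ ^ Module.finrank ℝ E := pow_pos (Real.sqrt_pos.2 hσ) _
  have h := Measure.integral_comp_smul volume (fun y => heatKernel σ y • g (x - y)) (Real.sqrt σ)
  simp_rw [heatKernel_one_eq_sqrt_pow_mul_heatKernel hσ, mul_smul, integral_smul, h,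
    abs_of_pos (inv_pos.2 hR), smul_smul, mul_inv_cancel₀ hR.ne', one_smul]

/-- For `σ ≤ 0` the scaled integral is the datum itself: `∫ G_1(z) • g(x - √σ z) dz = g x`
(`√σ = 0`, `∫ G_1 = 1`). [folklore] -/
theorem integral_heatKernel_one_smul_of_nonpos [CompleteSpace F] {σ : ℝ} (hσ : σ ≤ 0) (g : E → F)
    (x : E) : ∫ z, heatKernel 1 z • g (x - Real.sqrt σ • z) = g x := by
  simp [Real.sqrt_eq_zero'.2 hσ, integral_smul_const, integral_heatKernel_eq_one_holds one_pos]

/-- **Joint continuity of the scaled caloric integral** `(σ, x) ↦ ∫ G_1(z) • g(x - √σ z) dz` on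
all of `ℝ × E`, for bounded continuous `g` (dominated convergence with the fixed majorant
`‖g‖_∞ G_1`). For `σ > 0` this is `e^{σΔ} g (x)`, for `σ ≤ 0` it is `g x`; in particular
`e^{σΔ}g (x) → g(x₀)` as `(σ, x) → (0⁺, x₀)`. Evans, *PDE*, §2.3.1, Thm. 1 (iii). [cite: Evans2010, §2.3.1 Theorem 1(iii)] -/
theorem continuous_integral_heatKernel_one_smul {g : E → F} (hg : Continuous g) {C : ℝ}
    (hC : ∀ z, ‖g z‖ ≤ C) :
    Continuous fun q : ℝ × E => ∫ z, heatKernel 1 z • g (q.2 - Real.sqrt q.1 • z) := by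
  have hK := continuous_heatKernel (E := E) 1
  refine continuous_of_dominated (bound := fun z => heatKernel 1 z * C) ?_ ?_ ?_ ?_
  · intro q
    exact (hK.smul (hg.comp (continuous_const.sub (continuous_const.smul continuous_id))))
      |>.aestronglyMeasurable
  · intro q
    refine Eventually.of_forall fun z => ?_
    rw [norm_smul, Real.norm_of_nonneg (heatKernel_pos one_pos z).le]
    exact mul_le_mul_of_nonneg_left (hC _) (heatKernel_pos one_pos z).le
  · exact (integrable_heatKernel_holds one_pos).mul_const C
  · refine Eventually.of_forall fun z => ?_
    exact continuous_const.smul (hg.comp (continuous_snd.sub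
      ((Real.continuous_sqrt.comp continuous_fst).smul continuous_const)))

/-- **Continuity of `e^{σΔ} g` at `σ = 0⁺`, jointly in `(σ, x)`**: for bounded continuous `g`,
`e^{σΔ} g (x) → g(x₀)` as `(σ, x) → (0, x₀)` with `σ > 0`. Evans, *PDE*, §2.3.1, Thm. 1 (iii)
("`lim_{(x,t)→(x⁰,0), t>0} u(x, t) = g(x⁰)`"). [cite: Evans2010, §2.3.1 Theorem 1(iii)] -/
theorem tendsto_heatExtension_nhdsWithin_prod [CompleteSpace F] {g : E → F} (hg : Continuous g)
    {C : ℝ} (hC : ∀ z, ‖g z‖ ≤ C) (x₀ : E) :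
    Tendsto (fun q : ℝ × E => heatExtension g q.1 q.2) (𝓝[Ioi 0 ×ˢ univ] ((0 : ℝ), x₀))
      (𝓝 (g x₀)) := by
  have hH := (continuous_integral_heatKernel_one_smul hg hC).continuousAt (x := ((0 : ℝ), x₀))
  have hH' : Tendsto (fun q : ℝ × E => ∫ z, heatKernel 1 z • g (q.2 - Real.sqrt q.1 • z))
      (𝓝 ((0 : ℝ), x₀)) (𝓝 (g x₀)) := by
    simpa [integral_smul_const, integral_heatKernel_eq_one_holds one_pos] using hH.tendsto
  refine (hH'.mono_left nhdsWithin_le_nhds).congr' ?_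
  filter_upwards [self_mem_nhdsWithin] with q hq
  exact (heatExtension_eq_integral_heatKernel_one (mem_prod.1 hq).1 g q.2).symm

/-- **Joint continuity of `(σ, x) ↦ e^{σΔ} g (x)` on `(0, ∞) × E`** for bounded continuous `g`.
Evans, *PDE*, §2.3.1, Thm. 1 (i). [cite: Evans2010, §2.3.1 Theorem 1(i)] -/
theorem continuousOn_uncurry_heatExtension {g : E → F} (hg : Continuous g) {C : ℝ}
    (hC : ∀ z, ‖g z‖ ≤ C) :
    ContinuousOn (fun q : ℝ × E => heatExtension g q.1 q.2) (Ioi 0 ×ˢ univ) :=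
  ((continuous_integral_heatKernel_one_smul hg hC).continuousOn).congr fun q hq =>
    heatExtension_eq_integral_heatKernel_one (mem_prod.1 hq).1 g q.2

/-! ### Joint smoothness of `(σ, x) ↦ e^{σΔ} g (x)` on `(0, ∞) × E` for compactly supported `g` -/

/-- **Joint smoothness of the caloric extension of compactly supported data.** For `g` locally
integrable with compact support, `(σ, x) ↦ e^{σΔ} g (x)` is `C^∞` on `(0, ∞) × E`. Proof: near
`(σ₀, x₀)` the kernel may be replaced by a truncation `θ G_σ` (`θ` a bump equal to `1` on a large
ball), which is jointly smooth with `x`-support in a fixed compact set, so that Mathlib's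
`contDiffOn_convolution_left_with_param` applies. Evans, *PDE*, §2.3.1, Thm. 1 (i)
(`u ∈ C^∞(ℝⁿ × (0, ∞))`). [cite: Evans2010, §2.3.1 Theorem 1(i)] -/
theorem contDiffOn_uncurry_heatExtension {g : E → F} (hg : LocallyIntegrable g volume)
    (hc : HasCompactSupport g) {m : ℕ∞} :
    ContDiffOn ℝ m (fun q : ℝ × E => heatExtension g q.1 q.2) (Ioi 0 ×ˢ univ) := by
  rintro ⟨σ₀, x₀⟩ hq
  -- a radius containing the support of `g`
  obtain ⟨ρ, hρ⟩ : ∃ ρ, ∀ y ∈ tsupport g, ‖y‖ ≤ ρ := by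
    obtain ⟨ρ, hρ⟩ := hc.isCompact.isBounded.subset_closedBall 0
    exact ⟨ρ, fun y hy => mem_closedBall_zero_iff.1 (hρ hy)⟩
  set r : ℝ := ‖x₀‖ + 1 + |ρ| with hr
  have hr0 : 0 < r := by positivity
  let θ : ContDiffBump (0 : E) := ⟨r, r + 1, hr0, by linarith⟩
  -- the truncated kernel, jointly smooth with uniformly compact `x`-support
  set Kt : ℝ → E → ℝ := fun σ y => θ y * heatKernel σ y with hKt
  have hsmooth : ContDiffOn ℝ m (↿Kt) (Ioi (0 : ℝ) ×ˢ (univ : Set E)) := by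
    change ContDiffOn ℝ m (fun q : ℝ × E => θ q.2 * heatKernel q.1 q.2) (Ioi 0 ×ˢ univ)
    exact (θ.contDiff.comp contDiff_snd).contDiffOn.mul contDiffOn_uncurry_heatKernel
  have hsupp : ∀ σ y, σ ∈ Ioi (0 : ℝ) → y ∉ closedBall (0 : E) (r + 1) → Kt σ y = 0 := by
    intro σ y _ hy
    have : θ y = 0 := θ.zero_of_le_dist (by
      rw [mem_closedBall, not_le] at hy
      exact hy.le)
    simp [hKt, this]
  have hconv := contDiffOn_convolution_left_with_param (ContinuousLinearMap.lsmul ℝ ℝ) isOpen_Ioi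
    (isCompact_closedBall (0 : E) (r + 1)) hsupp hg hsmooth
  -- near `(σ₀, x₀)` the truncation is invisible
  have heq : ∀ q ∈ (Ioi (0 : ℝ) ×ˢ (univ : Set E)) ∩ (univ ×ˢ ball x₀ 1),
      (Kt q.1 ⋆[ContinuousLinearMap.lsmul ℝ ℝ, volume] g) q.2 = heatExtension g q.1 q.2 := by
    rintro ⟨σ, x⟩ ⟨-, -, hx⟩
    rw [heatExtension, convolution_def, convolution_def]
    refine integral_congr_ae (Eventually.of_forall fun y => ?_)
    by_cases hgy : g (x - y) = 0
    · simp [hgy]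
    · have hy : ‖x - y‖ ≤ ρ := hρ _ (subset_tsupport _ hgy)
      have hθ : θ y = 1 := θ.one_of_mem_closedBall (by
        rw [mem_closedBall, dist_zero_right]
        have h1 : ‖y‖ ≤ ‖x‖ + ‖x - y‖ := by
          calc ‖y‖ = ‖x - (x - y)‖ := by rw [sub_sub_cancel]
            _ ≤ ‖x‖ + ‖x - y‖ := norm_sub_le _ _
        have h2 : ‖x‖ ≤ ‖x₀‖ + 1 := by
          have := mem_ball_iff_norm.1 hx
          calc ‖x‖ = ‖(x - x₀) + x₀‖ := by rw [sub_add_cancel]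
            _ ≤ ‖x - x₀‖ + ‖x₀‖ := norm_add_le _ _
            _ ≤ 1 + ‖x₀‖ := by linarith
            _ = ‖x₀‖ + 1 := by ring
        show ‖y‖ ≤ r
        linarith [le_abs_self ρ])
      simp [hKt, hθ]
  have h2 : ContDiffOn ℝ m (fun q : ℝ × E => heatExtension g q.1 q.2)
      ((Ioi (0 : ℝ) ×ˢ (univ : Set E)) ∩ (univ ×ˢ ball x₀ 1)) :=
    (hconv.mono inter_subset_left).congr fun q hq => (heq q hq).symm
  refine (h2 (σ₀, x₀) ⟨hq, mem_univ _, mem_ball_self one_pos⟩).mono_of_mem_nhdsWithin ?_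
  exact inter_mem_nhdsWithin _ ((isOpen_univ.prod isOpen_ball).mem_nhds
    ⟨mem_univ _, mem_ball_self one_pos⟩)

/-! ### Derivatives fall on compactly supported smooth data -/

/-- `y ↦ G_σ(y) • h (x - y)` is integrable for continuous compactly supported `h` (continuous
integrand with compact support). [folklore] -/
theorem integrable_heatKernel_smul_comp_sub {G : Type*} [NormedAddCommGroup G] [NormedSpace ℝ G]
    {h : E → G} (hh : Continuous h) (hch : HasCompactSupport h) (σ : ℝ) (x : E) :
    Integrable (fun y => heatKernel σ y • h (x - y)) := by
  have hc' : HasCompactSupport fun y => h (x - y) := hch.comp_homeomorph (Homeomorph.subLeft x)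
  exact ((continuous_heatKernel σ).smul (hh.comp (continuous_const.sub continuous_id)))
    |>.integrable_of_hasCompactSupport hc'.smul_left

/-- The caloric extension of `C^n` compactly supported data is `C^n` in space, for every `σ`
(Mathlib `HasCompactSupport.contDiff_convolution_right`). [folklore] -/
theorem contDiff_heatExtension_of_hasCompactSupport {g : E → F} {n : ℕ∞} (hg : ContDiff ℝ n g)
    (hc : HasCompactSupport g) (σ : ℝ) : ContDiff ℝ n (heatExtension g σ) := by
  unfold heatExtension
  exact hc.contDiff_convolution_right _ (continuous_heatKernel σ).locallyIntegrable hg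

/-- **Derivatives fall on the data**: for `g ∈ C¹_c`, `D(e^{σΔ} g)(x) = e^{σΔ}(Dg)(x)` (the
caloric extension of the operator-valued field `Dg`), for every `σ` (Mathlib
`HasCompactSupport.hasFDerivAt_convolution_right`). Lemarié-Rieusset 2016, §6.2 (proof of
Prop. 6.1: `W_{νt} ∗ ∂^α u₀ = ∂^α (W_{νt} ∗ u₀)`). [folklore] -/
theorem hasFDerivAt_heatExtension_of_hasCompactSupport {g : E → F} (hg : ContDiff ℝ 1 g)
    (hc : HasCompactSupport g) (σ : ℝ) (x : E) :
    HasFDerivAt (heatExtension g σ) (heatExtension (fderiv ℝ g) σ x) x := by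
  have h := hc.hasFDerivAt_convolution_right (ContinuousLinearMap.lsmul ℝ ℝ)
    ((continuous_heatKernel σ).locallyIntegrable (μ := (volume : Measure E))) hg x
  have heq : (heatKernel σ ⋆[(ContinuousLinearMap.lsmul ℝ ℝ).precompR E, volume] fderiv ℝ g) x =
      heatExtension (fderiv ℝ g) σ x := by
    rw [heatExtension, convolution_def, convolution_def]
    refine integral_congr_ae (Eventually.of_forall fun y => ?_)
    ext v
    simp [ContinuousLinearMap.precompR_apply]
  rw [heq] at h
  exact h

/-- `D(e^{σΔ} g)(x) = e^{σΔ}(Dg)(x)` for `g ∈ C¹_c` (operator-valued form). [folklore] -/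
theorem fderiv_heatExtension_of_hasCompactSupport {g : E → F} (hg : ContDiff ℝ 1 g)
    (hc : HasCompactSupport g) (σ : ℝ) (x : E) :
    fderiv ℝ (heatExtension g σ) x = heatExtension (fderiv ℝ g) σ x :=
  (hasFDerivAt_heatExtension_of_hasCompactSupport hg hc σ x).fderiv

/-- `∂ᵥ(e^{σΔ} g)(x) = e^{σΔ}(∂ᵥg)(x)` for `g ∈ C¹_c` (directional form). [folklore] -/
theorem fderiv_heatExtension_apply_of_hasCompactSupport {g : E → F} (hg : ContDiff ℝ 1 g)
    (hc : HasCompactSupport g) (σ : ℝ) (x v : E) :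
    fderiv ℝ (heatExtension g σ) x v = heatExtension (fun z => fderiv ℝ g z v) σ x := by
  rw [fderiv_heatExtension_of_hasCompactSupport hg hc σ x, heatExtension_apply, heatExtension_apply,
    ContinuousLinearMap.integral_apply
      (integrable_heatKernel_smul_comp_sub (hg.continuous_fderiv one_ne_zero) (hc.fderiv ℝ) σ x) v]
  rfl

/-- **The caloric extension commutes with continuous linear maps** applied to compactly supported
continuous data: `e^{σΔ}(L ∘ g) = L ∘ e^{σΔ} g`. [folklore] -/
theorem heatExtension_clm_comp {G : Type*} [NormedAddCommGroup G] [NormedSpace ℝ G]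
    [CompleteSpace F] [CompleteSpace G] (L : F →L[ℝ] G) {g : E → F} (hg : Continuous g)
    (hc : HasCompactSupport g) (σ : ℝ) (x : E) :
    heatExtension (fun z => L (g z)) σ x = L (heatExtension g σ x) := by
  rw [heatExtension_apply, heatExtension_apply,
    ← L.integral_comp_comm (integrable_heatKernel_smul_comp_sub hg hc σ x)]
  exact integral_congr_ae (Eventually.of_forall fun y => (L.map_smul _ _).symm)

/-- The caloric extension of the zero field is zero. [folklore] -/
@[simp]
theorem heatExtension_zero_fun (σ : ℝ) : heatExtension (fun _ : E => (0 : F)) σ = 0 := by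
  funext x
  simp [heatExtension_apply]

/-- Finite sums of data: `e^{σΔ}(∑ gᵢ) = ∑ e^{σΔ} gᵢ` when every `y ↦ G_σ(y) • gᵢ(x - y)` is
integrable. [folklore] -/
theorem heatExtension_finset_sum {ι : Type*} (s : Finset ι) {g : ι → E → F} (σ : ℝ) (x : E)
    (hint : ∀ i ∈ s, Integrable (fun y => heatKernel σ y • g i (x - y))) :
    heatExtension (fun z => ∑ i ∈ s, g i z) σ x = ∑ i ∈ s, heatExtension (g i) σ x := by
  simp_rw [heatExtension_apply, Finset.smul_sum]
  exact integral_finsetSum s hint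

/-- **The Laplacian falls on the data**: for `g ∈ C²_c`, `Δ(e^{σΔ} g)(x) = e^{σΔ}(Δg)(x)` for
every `σ`. Lemarié-Rieusset 2016, §6.2 (proof of Prop. 6.1). [folklore] -/
theorem laplacian_heatExtension_of_hasCompactSupport [CompleteSpace F] {g : E → F}
    (hg : ContDiff ℝ 2 g) (hc : HasCompactSupport g) (σ : ℝ) (x : E) :
    (Δ (heatExtension g σ)) x = heatExtension (Δ g) σ x := by
  set b := stdOrthonormalBasis ℝ E with hb
  have hg1 : ContDiff ℝ 1 g := hg.of_le one_le_two
  -- the partial derivatives of `g` and their derivatives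
  have hgi : ∀ i, ContDiff ℝ 1 fun z => fderiv ℝ g z (b i) := fun i =>
    (hg.fderiv_right (m := 1) le_rfl).clm_apply contDiff_const
  have hgic : ∀ i, HasCompactSupport fun z => fderiv ℝ g z (b i) := fun i => hc.fderiv_apply ℝ _
  -- pure second derivatives as `fderiv ∘ fderiv` for `C²` maps
  have hpure : ∀ {v : E → F}, ContDiff ℝ 2 v → ∀ y e,
      iteratedFDeriv ℝ 2 v y ![e, e] = fderiv ℝ (fun z => fderiv ℝ v z e) y e := by
    intro v hv y e
    have hd : DifferentiableAt ℝ (fderiv ℝ v) y :=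
      ((hv.fderiv_right (m := 1) le_rfl).differentiable one_ne_zero) y
    rw [iteratedFDeriv_two_apply, fderiv_clm_apply hd (differentiableAt_const e)]
    simp
  have hsm : ContDiff ℝ 2 (heatExtension g σ) := contDiff_heatExtension_of_hasCompactSupport hg hc σ
  -- left-hand side
  have hL : (Δ (heatExtension g σ)) x =
      ∑ i, heatExtension (fun z => fderiv ℝ (fun z' => fderiv ℝ g z' (b i)) z (b i)) σ x := by
    rw [laplacian_eq_iteratedFDeriv_orthonormalBasis (heatExtension g σ) b]
    refine Finset.sum_congr rfl fun i _ => ?_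
    rw [hpure hsm]
    have h1 : (fun y => fderiv ℝ (heatExtension g σ) y (b i)) =
        heatExtension (fun z => fderiv ℝ g z (b i)) σ :=
      funext fun y => fderiv_heatExtension_apply_of_hasCompactSupport hg1 hc σ y (b i)
    rw [h1, fderiv_heatExtension_apply_of_hasCompactSupport (hgi i) (hgic i) σ x (b i)]
  -- right-hand side
  have hR : (Δ g) = fun z => ∑ i, fderiv ℝ (fun z' => fderiv ℝ g z' (b i)) z (b i) := by
    rw [laplacian_eq_iteratedFDeriv_orthonormalBasis g b]
    funext z
    exact Finset.sum_congr rfl fun i _ => hpure hg z (b i)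
  rw [hL, hR, heatExtension_finset_sum]
  intro i _
  exact integrable_heatKernel_smul_comp_sub (((hgi i).continuous_fderiv one_ne_zero).clm_apply
    continuous_const) ((hgic i).fderiv_apply ℝ _) σ x

/-- **The heat equation for smooth compactly supported data, with the Laplacian on the data**:
for `g ∈ C²_c` and `0 < σ`, `∂_σ e^{σΔ} g (x) = e^{σΔ}(Δg)(x)`. Evans, *PDE*, §2.3.1, Thm. 1 (ii)
combined with `laplacian_heatExtension_of_hasCompactSupport`. [cite: Evans2010, §2.3.1 Theorem 1(ii)] -/
theorem hasDerivAt_heatExtension_time_of_hasCompactSupport [CompleteSpace F] {g : E → F}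
    (hg : ContDiff ℝ 2 g) (hc : HasCompactSupport g) {σ : ℝ} (hσ : 0 < σ) (x : E) :
    HasDerivAt (fun s => heatExtension g s x) (heatExtension (Δ g) σ x) σ := by
  have hmem : MemLp g ∞ (volume : Measure E) :=
    hg.continuous.memLp_top_of_hasCompactSupport hc (volume : Measure E)
  have h := hasDerivAt_heatExtension_time hσ hmem le_top x
  rwa [laplacian_heatExtension_of_hasCompactSupport hg hc σ x] at h

/-! ### Sup and `L¹` bounds -/

/-- **Maximum principle for the caloric extension**: if `‖g‖ ≤ C` everywhere then
`‖e^{σΔ} g (x)‖ ≤ C` for `0 < σ` (`G_σ ≥ 0`, `∫ G_σ = 1`). Evans, *PDE*, §2.3.1, proof of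
Thm. 1. [folklore] -/
theorem norm_heatExtension_le {g : E → F} {C : ℝ} (hC : ∀ z, ‖g z‖ ≤ C) {σ : ℝ} (hσ : 0 < σ)
    (x : E) : ‖heatExtension g σ x‖ ≤ C := by
  rw [heatExtension_apply]
  have hint : Integrable (fun y => heatKernel σ y * C) (volume : Measure E) :=
    (integrable_heatKernel_holds hσ).mul_const C
  calc ‖∫ y, heatKernel σ y • g (x - y)‖ ≤ ∫ y, heatKernel σ y * C := by
        refine norm_integral_le_of_norm_le hint (Eventually.of_forall fun y => ?_)
        rw [norm_smul, Real.norm_of_nonneg (heatKernel_pos hσ y).le]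
        exact mul_le_mul_of_nonneg_left (hC _) (heatKernel_pos hσ y).le
    _ = C := by rw [integral_mul_const, integral_heatKernel_eq_one_holds hσ, one_mul]

/-- The caloric extension of an integrable field is integrable (`0 < σ`). Giga–Giga–Saal,
*Nonlinear PDEs*, §1.1.2. [folklore] -/
theorem integrable_heatExtension [CompleteSpace F] {g : E → F} (hg : Integrable g) {σ : ℝ}
    (hσ : 0 < σ) : Integrable (heatExtension g σ) :=
  memLp_one_iff_integrable.1 (memLp_heatExtension_holds (memLp_one_iff_integrable.2 hg) le_rfl hσ)

/-- **`L¹` contraction in `lintegral` form**: `∫⁻ ‖e^{σΔ} g‖ₑ ≤ ∫⁻ ‖g‖ₑ` for integrable `g` and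
`0 < σ`. Giga–Giga–Saal, *Nonlinear PDEs*, §1.1.2. [folklore] -/
theorem lintegral_enorm_heatExtension_le [CompleteSpace F] {g : E → F} (hg : Integrable g) {σ : ℝ}
    (hσ : 0 < σ) : ∫⁻ x, ‖heatExtension g σ x‖ₑ ≤ ∫⁻ x, ‖g x‖ₑ := by
  have h := eLpNorm_heatExtension_le_holds (memLp_one_iff_integrable.2 hg) le_rfl hσ
  simpa [eLpNorm_one_eq_lintegral_enorm] using h

end SmoothData

end Literature.Analysis.UnboundedOperators
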